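import Mathlib
import HarnessLib
import Summits.HubbardSuperconductivity.HubbardSuperconductivity.Theorems.KLProgrammeKLRegimeEngineTowerDoorToKitPrescribed

/-!
# Route `KLProgramme` — crux K3 ENGINE (stmt-HubbardSuperconductivity-20437 `KLRegimeEngineV17F2`), stub (b) v2, THE LEVELS PACKAGE (ℓ):
# instantiation (I1) — the kit's step right side is MONOTONE in its parameters (one kit instance from rows with different parameter floors)
# (cell gate-hubbard-kl, seat hubbard-kl-k3c2-p3 g12 as SUBSTITUTE typer while the E1 lineage is unseated — E1 may rename or supersede)

`towerBorn_le_law_tracks` has ONE `(σ, τ, ψ, Φ)` for every block and track, while the (I1) rows come with row-wise floors: block `0` in the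
trivial family (`Φ₀ = eα₀/κ₀²`), blocks `k ≥ 1` in the thin families (`Φ = eα/κ²`), the graded rows with `Φ ↦ 2Φ`, `τ ≥ (e³κ)², (e²(κ+ρ))²`, `ψ ≥ κ⁻², ρ⁻²`,
`σ = κ²`.  The instantiator takes the MAXIMUM of the floors; this file records that the kit's step right side only grows:

* `towerFO_mono` — `towerFO D σ μ p ≤ towerFO D σ′ μ′ p` for `0 ≤ σ ≤ σ′`, `0 ≤ μ ≤ μ′`;
* `kitTail_mono` — the tail `ψ^p·(e·V·(Φ·V)^N/(1 − Φ·V))` is monotone in `(ψ, Φ, V)` under the guard at the larger values;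
* **`kitStepRHS_mono`** — `towerFO D σ μ p + Σ_{n ∈ [2, N]} e·Φ^{n−1}·ψ^p·towerS D τ μ n p + ψ^p·e·V·(ΦV)^N/(1 − ΦV)`, `V = towerV D τ μ`, is monotone in
  `(σ, τ, ψ, Φ)` (guard `Φ′·towerV D τ′ μ < 1` at the larger values).
Pure real algebra.  Nothing asserts (ℓ), any stub, K3 or superconductivity.  [folklore]
-/

noncomputable section

namespace Summit.HubbardSuperconductivity.HubbardSuperconductivity.Theorems.EngineV8

set_option linter.dupNamespace false -- summit = problem name (single-conjunct summit), D-0017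

open Real Finset

/-- **`towerFO` is monotone in `σ` and in the sizes.** -/
theorem towerFO_mono {D p : ℕ} {σ σ' : ℝ} {μ μ' : ℕ → ℝ} (hσ : 0 ≤ σ) (hσσ : σ ≤ σ') (hμ : ∀ m, 0 ≤ μ m) (hμμ : ∀ m, μ m ≤ μ' m) :
    towerFO D σ μ p ≤ towerFO D σ' μ' p := by
  unfold towerFO
  refine sum_le_sum fun m _ => mul_le_mul (mul_le_mul_of_nonneg_left (pow_le_pow_left₀ hσ hσσ _) (Nat.cast_nonneg _)) (hμμ m) (hμ m) ?_
  have := hσ.trans hσσ; positivity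

/-- **The kit tail is monotone in `(Φ, V)`** under the guard at the larger values (`N` fixed). -/
theorem kitTail_mono {Φ Φ' V V' : ℝ} (hΦ : 0 ≤ Φ) (hΦΦ : Φ ≤ Φ') (hV : 0 ≤ V) (hVV : V ≤ V') (hguard : Φ' * V' < 1) (N : ℕ) :
    exp 1 * V * (Φ * V) ^ N / (1 - Φ * V) ≤ exp 1 * V' * (Φ' * V') ^ N / (1 - Φ' * V') := by
  have hΦ' : 0 ≤ Φ' := hΦ.trans hΦΦ
  have hV' : 0 ≤ V' := hV.trans hVV
  have hΦV : Φ * V ≤ Φ' * V' := mul_le_mul hΦΦ hVV hV hΦ'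
  have h1 : 0 < 1 - Φ' * V' := sub_pos.2 hguard
  have h1' : 0 < 1 - Φ * V := by linarith
  refine div_le_div₀ (by positivity) ?_ h1 (by linarith)
  exact mul_le_mul (mul_le_mul_of_nonneg_left hVV (exp_pos 1).le) (pow_le_pow_left₀ (mul_nonneg hΦ hV) hΦV N)
    (pow_nonneg (mul_nonneg hΦ hV) N) (by positivity)

/-- **THE KIT's STEP RIGHT SIDE IS MONOTONE IN `(σ, τ, ψ, Φ)`** (sizes `μ ≥ 0` fixed; guard at the larger values). -/
theorem kitStepRHS_mono {D N p : ℕ} {σ σ' τ τ' ψ ψ' Φ Φ' : ℝ} {μ : ℕ → ℝ} (hμ : ∀ m, 0 ≤ μ m)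
    (hσ : 0 ≤ σ) (hσσ : σ ≤ σ') (hτ : 0 ≤ τ) (hττ : τ ≤ τ') (hψ : 0 ≤ ψ) (hψψ : ψ ≤ ψ') (hΦ : 0 ≤ Φ) (hΦΦ : Φ ≤ Φ')
    (hguard : Φ' * towerV D τ' μ < 1) :
    towerFO D σ μ p + ∑ n ∈ Icc 2 N, exp 1 * Φ ^ (n - 1) * ψ ^ p * towerS D τ μ n p +
        ψ ^ p * (exp 1 * towerV D τ μ * (Φ * towerV D τ μ) ^ N / (1 - Φ * towerV D τ μ)) ≤
      towerFO D σ' μ p + ∑ n ∈ Icc 2 N, exp 1 * Φ' ^ (n - 1) * ψ' ^ p * towerS D τ' μ n p +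
        ψ' ^ p * (exp 1 * towerV D τ' μ * (Φ' * towerV D τ' μ) ^ N / (1 - Φ' * towerV D τ' μ)) := by
  have hτ' : 0 ≤ τ' := hτ.trans hττ
  have hΦ' : 0 ≤ Φ' := hΦ.trans hΦΦ
  have hψ' : 0 ≤ ψ' := hψ.trans hψψ
  have hV0 : 0 ≤ towerV D τ μ := towerV_nonneg hτ hμ
  have hVV : towerV D τ μ ≤ towerV D τ' μ := towerV_mono hτ hττ hμ fun _ => le_rfl
  have hV'0 : 0 ≤ towerV D τ' μ := hV0.trans hVV
  refine add_le_add (add_le_add (towerFO_mono hσ hσσ hμ fun _ => le_rfl) (sum_le_sum fun n _ => ?_)) ?_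
  · have hS0 : 0 ≤ towerS D τ μ n p := towerS_nonneg hτ hμ n p
    have hS : towerS D τ μ n p ≤ towerS D τ' μ n p := towerS_mono hτ hττ hμ fun _ => le_rfl
    exact mul_le_mul (mul_le_mul (mul_le_mul_of_nonneg_left (pow_le_pow_left₀ hΦ hΦΦ _) (exp_pos 1).le)
      (pow_le_pow_left₀ hψ hψψ _) (pow_nonneg hψ _) (by positivity)) hS hS0 (by positivity)
  · have ht := kitTail_mono hΦ hΦΦ hV0 hVV hguard N
    have ht0 : 0 ≤ exp 1 * towerV D τ μ * (Φ * towerV D τ μ) ^ N / (1 - Φ * towerV D τ μ) := by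
      have hg : Φ * towerV D τ μ < 1 := lt_of_le_of_lt (mul_le_mul hΦΦ hVV hV0 hΦ') hguard
      exact div_nonneg (by positivity) (sub_nonneg.2 hg.le)
    exact mul_le_mul (pow_le_pow_left₀ hψ hψψ _) ht ht0 (pow_nonneg hψ' _)

end Summit.HubbardSuperconductivity.HubbardSuperconductivity.Theorems.EngineV8

end
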